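import Summits.HubbardSuperconductivity.HubbardSuperconductivity.Theorems.AnisotropyChordTransferFibre3FinX3Eval
import Summits.HubbardSuperconductivity.HubbardSuperconductivity.Theorems.AnisotropyChordTransferFibre3FinX5P36q029
import Summits.HubbardSuperconductivity.HubbardSuperconductivity.Theorems.AnisotropyChordTransferFibre3FinX5P36q030

/-!
# Route `AnisotropyChord` / H0 rotor rung: FIN per-`L` GM₃ (X5), `L = 36` — rows `N₁` / D / side-condition cell facts, part `p29`

Kernel facts (`decide +kernel`) for cert cells 49 of the per-`L` grid of `L = 36`: `xbnCellAny2` (row `N₁` on XB2 point wedges recomputed in the kernel, exporting the literal brackets `nt ⊇ T⁺ − 3λ₂` and `tb ⊇ T⁺·D`), `xdCellAnyN0` (row D, reads `nt`), `sdCellAnyZN` (side condition, reads `nt`); evaluators `…FinX3Eval` / `…FinX5Eval`; constants from the compiled design probe (x3probe/x3plan, margins c ×0.985, b ×1.03, aD ×1.03); assembled in `…FinX5GM3ThirtySix`.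
Prover seat `hubbard-h0-rotor-p3` g9; helper for piece A = stmt-HubbardSuperconductivity-23918 of rung 19089 (`--supports`, helper class).
WHAT THIS IS NOT: nothing here proves superconductivity in the Hubbard model (rotor TARGET as worded stays FALSE, g15 verdict); kernel facts for the FIN certificate of ONE conditional reduction.  Tree imports only; zero data; standard axioms.
-/

set_option linter.dupNamespace false
set_option autoImplicit false

namespace Summit.HubbardSuperconductivity.HubbardSuperconductivity.Theorems.AnisotropyChord.Transfer.Fibre3

namespace FinXD

open FinXB FinCell Hole2

set_option maxHeartbeats 4000000 in
/-- row `N₁` of cell 49 of `L = 36` (`c = 121/200`), exporting `nt`, `tb`. [folklore] -/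
theorem xn36_49 : xbnCellAny2 36 (49/50 : ℚ) 179964883150355 186443618943768 (121/200 : ℚ) ((-1151734917142 : ℤ), (1501054352069 : ℤ)) ((538738169366106 : ℤ), (560836656351190 : ℤ)) = true := by
  unfold xbnCellAny2
  rw [twp36_29_eq, twp36_30_eq]
  decide +kernel

set_option maxHeartbeats 4000000 in
/-- row D of cell 49 of `L = 36` (`aD = 113/1000`). [folklore] -/
theorem xd36_49 : xdCellAnyN0 36 (49/50 : ℚ) 179964883150355 186443618943768 (113/1000 : ℚ) ((-1151734917142 : ℤ), (1501054352069 : ℤ)) = true := by decide +kernel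

set_option maxHeartbeats 4000000 in
/-- side condition of cell 49 of `L = 36` (`c, b = 61/100, aD`). [folklore] -/
theorem sd36_49 : sdCellAnyZN 36 (49/50 : ℚ) 100 179964883150355 186443618943768 ((121/200 : ℚ), (61 : ℕ), (113/1000 : ℚ)) ((-1151734917142 : ℤ), (1501054352069 : ℤ)) = true := by decide +kernel

end FinXD

end Summit.HubbardSuperconductivity.HubbardSuperconductivity.Theorems.AnisotropyChord.Transfer.Fibre3
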